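import Literature.MathematicalPhysics.QuantumFieldTheory.Balaban1983to89.B9BetaRangeKLevelV1

/-!
# `Balaban1983to89.B9BetaOntoOfBoxLevels` — [Balaban1984PropagatorsII] (2.1)–(2.3) p. 224 ∕ (2.45) p. 231: THE CARRIER-BLOCK MAP `β` IS ONTO `𝔅`
# (every member is SECTION-CARRYING) WHEN EVERY DOMAIN `Ω_{j+1}` IS A COORDINATE BOX AT BLOCK LEVEL `j` AND `d + 1 ≥ 2` — the corner-free sub-class on
# which the section-carrying member packages of cell `lit-balaban` (and this seat's `B9Conv348OfRegYP335AtLettersY`, `B9Thm310DeltaAIsUnitOfRegYP335AtLettersY`)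
# reach EVERY member (cell `pub-ymgap`, seat `dag-n06-j` gen 31; IR-N06-SECTION, OFFER-1)

T. Bałaban, *Propagators and renormalization transformations for lattice gauge theories. II*, Commun. Math. Phys. **96** (1984) 223–250
[`Balaban1984PropagatorsII`, "[4]"]: (2.1)–(2.3) p. 224 (the nested family `Ω_k ⊂ … ⊂ Ω_1`, unions of big blocks; `Λ_j`; the index bonds), (2.45) p. 231
(the blocks `𝔅`).  T. Bałaban, *Large field renormalization. I*, Commun. Math. Phys. **122** (1989) 175–202 [`Balaban1989LargeFieldI`] p. 177: *«all the regions
connected with the last N steps are rectangular parallelepipeds»* — the situation this file serves.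

statement-level skeleton of published theorems with citation tags; proofs where landed; nothing here is a claim about the Yang–Mills mass gap

WHY THIS FILE (IR-N06-SECTION, lit-balaban lead g37's question 2026-08-29: «does the N06 certificate need inner-corner members at all?»).  The member-level
packages of cell `lit-balaban` (FILE 10-D, FILE 9, ASM2) carry the SECTION binder `hι : ∀ s, β (ιB s) = s`, inhabitable iff `β` is onto `𝔅`, i.e. iff the
family `{Ω_j}` has no INNER CORNER (dag-n06-i `B9BetaRangeKLevelV1.surjective_beta_iff`: every `𝔅`-block has a non-deep forward neighbour or a backward
neighbour outside `Ω_j^{(j)}`).  An inner corner is a RE-ENTRANT corner of some `Ω_{j+1}`.  THIS FILE proves the elementary combinatorial fact that a family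
ALL of whose `Ω_{j+1}` (`1 ≤ j < k`) are COORDINATE BOXES at block level `j` — «deepness of a `j`-block is a product condition on its coordinates» — has none,
provided `d + 1 ≥ 2`: if the `j`-block `y` of a level-`j` site is not deep, some coordinate `y_ν` lies outside the `ν`-th factor; for any `μ ≠ ν` the forward
neighbour `y + e_μ` has the same `ν`-coordinate, hence is not deep either.  (In dimension `1` the statement fails: the block just left of an interval has its only
forward neighbour inside.)  So box-level members — in particular the rectangular-parallelepiped families of [LF-I]'s last `N` steps and every constant-level
member — are served by the section-carrying packages BY NAME.

WHAT IS PROVED (sorry-free; 0 `def`; nothing of [4] asserted).  «BOX AT BLOCK LEVEL `j`» below means the displayed hypothesis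
`∃ I : ∀ ν, Set (ZMod N_j), ∀ y, Deep j y ↔ ∀ ν, y ν ∈ I ν` (deepness of `j`-blocks is a coordinate product).
* `not_deep_level_k` (no `k`-block is deep: `Ω_{k+1} = ∅`; the generic-`D` twin of t2s-1's cube-member `not_deep_top`), `not_deep_iterBlockOf_of_lev_eq` (the `j`-block of a level-`j` site is not deep, `j < k`),
  (private) `exists_ne_fin` (`d + 1 ≥ 2` ⇒ `∃ μ ≠ ν`; cf. `B9SupplySockB9P3ZdSocketBoundaryMode.exists_ne_fin` on `Fin d`), `exists_not_deep_shift_of_deepIsBox` (pointwise form).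
* ★★ `surjective_beta_of_deepIsBox` — `1 ≤ d`, `1 ≤ k`, box at block level `j` for every `1 ≤ j < k` ⟹ `Function.Surjective (β hN D hk)`.
* ★ `deepIsBox_of_levBox` (a coordinate box OF FINE SITES `{x | j+1 ≤ lev x} = {x | ∀ ν, x ν ∈ J ν}` ⇒ box at block level `j`; a fine site of the block from r05's
  `B6ScalarChartV1.exists_iterBlockOf_eq`, one coordinate varied), ★★ `surjective_beta_of_levBoxes` (every `Ω_{j+1}` a coordinate box of fine sites ⇒ `β` onto).

HONEST SCOPE.  Pure combinatorics of [4]'s index sets on the cell's torus chart; whether the members a consumer needs ARE box-level is not decided here (the N06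
certificate of record ranges over def-Y's `MemberY` = all [4]-families; the small-field hierarchies of [I]–[III] have re-entrant corners generically); bookkeeping —
NOT a node discharge, NOT summit progress; count-neutral; nothing continuum ∕ OS ∕ mass gap ∕ Clay.  Cell `pub-ymgap` (HUMAN RULING D-0062), Track A node N06,
seat `pub-ymgap-dag-n06-j` (harness re-seat gen 31), 2026-08-29.  No `sorry`, no `axiom`, no `instance`, no `notation`, no `def`.  NEW file; nothing landed is modified.
RELATED, NOT DUPLICATED: dag-n06-i `B9BetaRangeKLevelV1` (the characterisation, USED BY NAME), dag-n06-k `B9IndexBondFaithful.exists_faithful_kIdx` (faithful maps at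
every member — the other road).
-/

namespace Literature.MathematicalPhysics.QuantumFieldTheory.Balaban1983to89.B9BetaOntoOfBoxLevels

open LatticeFieldCalculus
open B5Eq118OneStroke (iterBlockOf iterBlockOf_succ)
open B6MultiLevelBoxOperator (N0)
open B6MultiLevelTorusOperator (TDomains)
open B6GlobalChartV1 (PV toBox domT iterBlockOf_mem_domT_iff)
open B6Ineq2142KLevelV1 (β)
open B9BetaRangeKLevelV1 (surjective_beta_iff)

variable {d ℓ : ℕ} {m K : ℕ} {hd : 1 ≤ d + 1} {hL : Odd (ℓ + 1) ∧ 1 < ℓ + 1}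
variable {Mh k R : ℕ} {P' : Fin (d + 1) → ℕ}
variable (hN : ∀ μ, N0 ℓ Mh k P' μ = (PV d ℓ m K hd hL).sitesPerDir 0) (D : TDomains d ℓ Mh k P' R) (hk : k ≤ m + K)

/-- no `k`-block is deep (`Ω_{k+1} = ∅`). [cite: Balaban1984PropagatorsII, (2.1) p.224, bookkeeping] -/
theorem not_deep_level_k (y : Site (PV d ℓ m K hd hL) k) : ¬ (domT hN D hk).Deep k y := by
  intro h
  have hempty : (domT hN D hk).Om (k + 1) = ∅ := (domT hN D hk).Om_eq_empty (by show k < k + 1; omega)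
  unfold B6SectADomainsV1.Domains.Deep at h
  rw [hempty] at h
  simp at h

/-- the `j`-block of a site of level `j < k` is NOT deep (dictionary `Ω_{j+1} ↔ {lev ≥ j+1}`). [cite: Balaban1984PropagatorsII, (2.1)–(2.4) p.224, bookkeeping] -/
theorem not_deep_iterBlockOf_of_lev_eq (x : Site (PV d ℓ m K hd hL) 0) {j : ℕ} (hj : D.lev (toBox hN x) = j) (hjk : j < k) :
    ¬ (domT hN D hk).Deep j (iterBlockOf j x) := by
  intro h
  unfold B6SectADomainsV1.Domains.Deep at h
  rw [← iterBlockOf_succ] at h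
  have := (iterBlockOf_mem_domT_iff hN D hk (by omega) (by omega) x).1 h
  omega

/-- `d + 1 ≥ 2` ⇒ every direction has a different one. [folklore] [cite: Balaban1984PropagatorsII, p.224, bookkeeping] -/
private theorem exists_ne_fin (hd1 : 1 ≤ d) (ν : Fin (d + 1)) : ∃ μ : Fin (d + 1), μ ≠ ν := by
  by_cases h : (ν : ℕ) = 0
  · exact ⟨⟨1, by omega⟩, fun e => by have := congrArg Fin.val e; simp at this; omega⟩
  · exact ⟨⟨0, by omega⟩, fun e => by have := congrArg Fin.val e; simp at this; omega⟩

/-- the pointwise form: at a site of level `j`, SOME forward neighbour of its `j`-block is not deep (box levels, `d + 1 ≥ 2`).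
[cite: Balaban1984PropagatorsII, (2.3) p.224 + (2.45) p.231, bookkeeping] -/
theorem exists_not_deep_shift_of_deepIsBox (hd1 : 1 ≤ d)
    (hbox : ∀ j, 1 ≤ j → j < k → (∃ I : ∀ ν : Fin (d + 1), Set (ZMod ((PV d ℓ m K hd hL).sitesPerDir j)),
      ∀ y : Site (PV d ℓ m K hd hL) j, (domT hN D hk).Deep j y ↔ ∀ ν, y ν ∈ I ν))
    (x : Site (PV d ℓ m K hd hL) 0) (j : ℕ) (hj : D.lev (toBox hN x : Fin (d + 1) → ℤ) = j) :
    ∃ μ, ¬ (domT hN D hk).Deep j ((iterBlockOf j x).shift μ) := by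
  have hj1 : 1 ≤ j := hj ▸ D.one_le_lev _
  have hjk : j ≤ k := hj ▸ D.lev_le _
  rcases Nat.lt_or_ge j k with hlt | hge
  · obtain ⟨I, hI⟩ := hbox j hj1 hlt
    have hnot : ¬ (domT hN D hk).Deep j (iterBlockOf j x) := not_deep_iterBlockOf_of_lev_eq hN D hk x hj hlt
    rw [hI] at hnot
    push Not at hnot
    obtain ⟨ν, hν⟩ := hnot
    obtain ⟨μ, hμ⟩ := exists_ne_fin hd1 ν
    refine ⟨μ, ?_⟩
    rw [hI]
    intro hall
    apply hν
    have e : (iterBlockOf j x).shift μ ν = (iterBlockOf j x) ν := by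
      show Function.update (iterBlockOf j x) μ _ ν = _
      exact Function.update_of_ne hμ.symm _ _
    rw [← e]
    exact hall ν
  · have hjk' : j = k := le_antisymm hjk hge
    subst hjk'
    exact ⟨⟨0, Nat.succ_pos d⟩, not_deep_level_k hN D hk _⟩

/-- ★★ **BOX-LEVEL FAMILIES ARE SECTION-CARRYING**: if `d + 1 ≥ 2`, `1 ≤ k`, and for every `1 ≤ j < k` deepness at block level `j` is a coordinate product
then the carrier-block map `β` is ONTO `𝔅` — no inner corner; so lit-balaban's section binder `hι` is inhabitable at such a member (take
`ιB s := (this s).choose`). [cite: Balaban1984PropagatorsII, (2.3) p.224 + (2.45) p.231; Balaban1989LargeFieldI, p.177] -/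
theorem surjective_beta_of_deepIsBox (hd1 : 1 ≤ d) (hk1 : 1 ≤ k)
    (hbox : ∀ j, 1 ≤ j → j < k → (∃ I : ∀ ν : Fin (d + 1), Set (ZMod ((PV d ℓ m K hd hL).sitesPerDir j)),
      ∀ y : Site (PV d ℓ m K hd hL) j, (domT hN D hk).Deep j y ↔ ∀ ν, y ν ∈ I ν)) :
    Function.Surjective (β hN D hk) := by
  rw [surjective_beta_iff hN D hk hk1]
  intro x
  exact Or.inl (exists_not_deep_shift_of_deepIsBox hN D hk hd1 hbox x _ rfl)

/-! ## The fine-site form: `Ω_{j+1}` a coordinate box OF FINE SITES ⇒ a box at block level `j` -/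

/-- ★ **A COORDINATE BOX OF FINE SITES IS A BOX AT EVERY BLOCK LEVEL**: if the fine sites of `Ω_{j+1}` (`1 ≤ j`, `j + 1 ≤ k`) form a coordinate product
`{x | ∀ ν, x ν ∈ J ν}`, then deepness of `j`-blocks is a coordinate product at block level `j` (factor `ν`: «every fine `ν`-label over the `(j+1)`-interval
of `t` lies in `J ν`»). [cite: Balaban1984PropagatorsII, (2.1)–(2.3) p.224; Balaban1989LargeFieldI, p.177, bookkeeping] -/
theorem deepIsBox_of_levBox {j : ℕ} (hj1 : 1 ≤ j) (hjk : j + 1 ≤ k)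
    (J : ∀ ν : Fin (d + 1), Set (ZMod ((PV d ℓ m K hd hL).sitesPerDir 0)))
    (hJ : ∀ x : Site (PV d ℓ m K hd hL) 0, j + 1 ≤ D.lev (toBox hN x : Fin (d + 1) → ℤ) ↔ ∀ ν, x ν ∈ J ν) :
    ∃ I : ∀ ν : Fin (d + 1), Set (ZMod ((PV d ℓ m K hd hL).sitesPerDir j)),
      ∀ y : Site (PV d ℓ m K hd hL) j, (domT hN D hk).Deep j y ↔ ∀ ν, y ν ∈ I ν := by
  classical
  have hjm : j + 1 ≤ m + K := hjk.trans hk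
  -- the factor sets
  refine ⟨fun ν => {t | ∀ c : ZMod ((PV d ℓ m K hd hL).sitesPerDir 0), c.val / (ℓ + 1) ^ (j + 1) = t.val / (ℓ + 1) → c ∈ J ν}, fun y => ?_⟩
  -- `Deep j y ↔ ∀ x', B^{j+1}(x') = blockOf y → j+1 ≤ lev x'`
  have hdeep : (domT hN D hk).Deep j y ↔
      ∀ x' : Site (PV d ℓ m K hd hL) 0, iterBlockOf (j + 1) x' = blockOf y → j + 1 ≤ D.lev (toBox hN x' : Fin (d + 1) → ℤ) := by
    have hj0 : j + 1 ≠ 0 := by omega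
    simp only [B6SectADomainsV1.Domains.Deep, domT, hj0, if_false, hjk, if_true, Finset.mem_filter, Finset.mem_univ, true_and]
  -- `B^{j+1}(x') = blockOf y` in labels
  have hlab : ∀ x' : Site (PV d ℓ m K hd hL) 0, iterBlockOf (j + 1) x' = blockOf y ↔
      ∀ ν, (x' ν).val / (ℓ + 1) ^ (j + 1) = (y ν).val / (ℓ + 1) := by
    intro x'
    constructor
    · intro h ν
      have h1 := B5Eq118OneStroke.val_iterBlockOf (P := PV d ℓ m K hd hL) (j + 1) hjm x' ν
      rw [h, Site.val_blockOf hjm] at h1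
      exact h1.symm
    · intro h
      funext ν
      apply ZMod.val_injective
      rw [B5Eq118OneStroke.val_iterBlockOf (P := PV d ℓ m K hd hL) (j + 1) hjm, Site.val_blockOf hjm]
      exact h ν
  rw [hdeep]
  constructor
  · -- a deep block: every fine `ν`-label over its `(j+1)`-interval is in `J ν` (vary one coordinate of a fine site of the block)
    intro hD ν c hc
    obtain ⟨x₀, hx₀⟩ := B6ScalarChartV1.exists_iterBlockOf_eq (hd := hd) (hL := hL) hjm (blockOf y)
    have hx₀' := (hlab x₀).1 hx₀
    have hx' : iterBlockOf (j + 1) (Function.update x₀ ν c) = blockOf y := by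
      refine (hlab _).2 fun ν' => ?_
      by_cases h : ν' = ν
      · subst h; rw [Function.update_self]; exact hc
      · rw [Function.update_of_ne h]; exact hx₀' ν'
    have := ((hJ _).1 (hD _ hx')) ν
    rwa [Function.update_self] at this
  · -- conversely
    intro hI x' hx'
    refine (hJ x').2 fun ν => hI ν (x' ν) ?_
    exact ((hlab x').1 hx') ν

/-- ★★ **FINE-SITE FORM**: if `d + 1 ≥ 2`, `1 ≤ k`, and every `Ω_{j+1}` (`1 ≤ j < k`) is a coordinate box of fine sites, then `β` is onto `𝔅` — the member is
section-carrying (rectangular-parallelepiped families, [LF-I] p.177; constant-level members trivially).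
[cite: Balaban1984PropagatorsII, (2.3) p.224 + (2.45) p.231; Balaban1989LargeFieldI, p.177] -/
theorem surjective_beta_of_levBoxes (hd1 : 1 ≤ d) (hk1 : 1 ≤ k)
    (hbox : ∀ j, 1 ≤ j → j < k → ∃ J : ∀ ν : Fin (d + 1), Set (ZMod ((PV d ℓ m K hd hL).sitesPerDir 0)),
      ∀ x : Site (PV d ℓ m K hd hL) 0, j + 1 ≤ D.lev (toBox hN x : Fin (d + 1) → ℤ) ↔ ∀ ν, x ν ∈ J ν) :
    Function.Surjective (β hN D hk) :=
  surjective_beta_of_deepIsBox hN D hk hd1 hk1 fun j hj hjk => by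
    obtain ⟨J, hJ⟩ := hbox j hj hjk
    exact deepIsBox_of_levBox hN D hk hj (by omega) J hJ

end Literature.MathematicalPhysics.QuantumFieldTheory.Balaban1983to89.B9BetaOntoOfBoxLevels
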